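import Summits.HodgeConjecture.HodgeConjecture.Theses.BiquadraticSecantLift
import Summits.HodgeConjecture.HodgeConjecture.Theorems.BiquadraticSecantLiftTwelvefoldHOne
import Literature.AlgebraicGeometry.Deligne1982.WeilSpaceComplexification
import Literature.AlgebraicGeometry.Deligne1982.WeilTypeCMWeilClassesHodge
import Literature.AlgebraicGeometry.HodgeTheory.WeilClassesFieldIsogenyInvariance
import Literature.AlgebraicGeometry.HodgeTheory.AbelianVarietyPullbackAlgebraicClasses
import Literature.AlgebraicGeometry.HodgeTheory.AbelianVarietyEndomorphismsHOne
import HarnessLib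

/-!
# BiquadraticSecantLift · X3 `BiquadraticWeilDescent` — PROVED

Closes crux X3 (stmt-HodgeConjecture-22134) of route-HodgeConjecture-BiquadraticSecantLift: for `d, m ≥ 1`, `m` not a
square, an abelian sixfold `(A, φ)` with `φ² = -d`, and `(A ⊞ A, η = (φ ⊞ φ) ≫ (𝟙 + ψ_m))` a Weil-type CM datum for
`R_(d,m)` (`L = ℚ(η) = ℚ(√-d, √m)`), IF every rational `(3,3)` class of the complexified `L`-Weil space
`W_L ⊗ ℂ = weilClassesField (A ⊞ A) η R_(d,m)(T²) 6` is algebraic THEN every (rational, `(3,3)`) class of the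
`K`-Weil plane `W_K ⊗ ℂ = weilClassesOf A φ 3 d` is algebraic.

Proof (Deligne 1982, §4: (4.3)–(4.4) and the functoriality of `B = A ⊗_K L`; van Geemen 1994, 4.8–4.10), on the
tree's carriers:

* §1 the hypothesis makes ALL of `W_L ⊗ ℂ` algebraic (`W_L ⊗ ℂ` is spanned by its rational classes, each of type
  `(3,3)` on a Weil-type datum: `Deligne1982.IsWeilTypeCM.weilClassesField_le_algebraicClasses_of_forall_isRationalClass`,
  `….isOfHodgeType_of_mem_weilClassesField'`);
* §2–§4 **`W_K(A) ⊗ ℂ ⊆ ι₀^*(W_L(B) ⊗ ℂ)`** for `B = ⨁_{Fin 2} A`, `ι₀ = biproduct.ι 0`: under `H^r = ⋀^r H¹`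
  (`pullbackEigenclasses_eq_map_wedgeToCup`) the Weil line `⋀⁶ V_μ(A)` (`μ = ± i√d`; `φ^*` is diagonalisable, so the
  eigenclass line IS `⋀⁶ V_μ`, `range_map_eigenspace_eq_pencilEigenspace`) is `⋀⁶ ι₀^*` of `⋀⁶ V_τ(B)`,
  `τ = μ(1 + √m)` a root of `R_(d,m)(T²)`, because `V_τ(B) = J_{√m} V_μ(A)` (X2's `eigenspace_etaTwo_eq_map`, the graph
  `J_λ = π₀^* + λ π₁^*`) and `ι₀^* J_λ = id`; and `⋀⁶ V_τ(B) ⊆ W_L(B) ⊗ ℂ` (`range_map_eigenspace_le_pencilEigenspace`,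
  `pullbackEigenclasses_le_weilClassesField`);
* §5 transport `⨁_{Fin 2} A → A ⊞ A` along `biprodIsoTwelvefold` (`inl ≫ e.hom = ι₀`, `weilClassesField_map_le_of_comm`);
* §6 pull-back along `inl : A → A ⊞ A` preserves algebraic classes (`map_mem_algebraicClasses_of_abelianVariety`).

This is NOT a case of the Hodge conjecture: HC is NOT proved here (X3 is a transfer statement; the open input is X1).

## References
[cite: Deligne1982HodgeCycles, §4 (4.3)–Prop. 4.4 and proof of Thm. 4.8 (re-edition pp. 30–34)]
[cite: vanGeemen1994HodgeAV, 3.6, 4.8–4.10 and proof of Lemma 5.2] [cite: MoonenZarhin1998WeilClasses, §1]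
-/

-- every declaration of this problem lives in `Summit.HodgeConjecture.HodgeConjecture.…` (summit = sub-problem)
set_option linter.dupNamespace false

noncomputable section

open CategoryTheory CategoryTheory.Limits Polynomial Module
open Literature.AlgebraicTopology.SingularHomology
open Literature.AlgebraicGeometry.HodgeTheory
open Literature.AlgebraicGeometry.Motives (AbelianVariety IsSmoothProjective ComplexPoints)
open Literature.AlgebraicGeometry.Deligne1982
open Literature.AlgebraicGeometry.Pohlmann1968 (map_ι_map_π_self map_ι_map_π_ne)

namespace Summit.HodgeConjecture.HodgeConjecture.BiquadraticSecantLift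

/-! ## §1 Linear algebra: lifting wedges of eigenvectors along a linear map -/

/-- If `W ⊆ g(U)` then `⋀ⁿ W ⊆ (⋀ⁿ g)(⋀ⁿ U)` (inside `⋀ⁿ N`, resp. `⋀ⁿ M`): lift each vector of a pure wedge. -/
theorem range_exteriorPower_map_subtype_le_map {L : Type*} [Field L] {M N : Type*} [AddCommGroup M] [Module L M]
    [AddCommGroup N] [Module L N] (g : M →ₗ[L] N) (U : Submodule L M) (W : Submodule L N) (hW : W ≤ U.map g)
    (n : ℕ) :
    LinearMap.range (exteriorPower.map n W.subtype) ≤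
      (LinearMap.range (exteriorPower.map n U.subtype)).map (exteriorPower.map n g) := by
  rw [LinearMap.range_eq_map, ← exteriorPower.ιMulti_span, Submodule.map_span, Submodule.span_le]
  rintro _ ⟨_, ⟨w, rfl⟩, rfl⟩
  rw [exteriorPower.map_apply_ιMulti]
  have h : ∀ j, ∃ u : U, g u = (w j : N) := fun j => by
    obtain ⟨u, hu, hgu⟩ := hW (w j).2
    exact ⟨⟨u, hu⟩, hgu⟩
  choose u hu using h
  refine ⟨exteriorPower.ιMulti L n (U.subtype ∘ u), ⟨exteriorPower.ιMulti L n u, by rw [exteriorPower.map_apply_ιMulti]⟩, ?_⟩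
  rw [exteriorPower.map_apply_ιMulti]
  congr 1
  funext j
  exact hu j

variable {A : AbelianVariety ℂ} {φ : A ⟶ A} {d m : ℕ}

/-! ## §2 `H¹`: `V_μ(A) = ι₀^* V_{μ(1+λ)}(⨁_{Fin 2} A)` -/

/-- **`V_μ(A) ⊆ ι₀^*(V_{μ(1+λ)}(B))`** on `H¹` (`B = ⨁_{Fin 2} A`): `V_{μ(1+λ)}(B) = J_λ V_μ(A)` and `ι₀^* J_λ = id`. -/
theorem eigenspace_le_map_ι_eigenspace_etaTwo (hφ : φ ≫ φ = -(d • 𝟙 A)) (hd : (d : ℂ) ≠ 0) {μ lam : ℂ}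
    (hμ : μ ^ 2 = -(d : ℂ)) (hlam : lam ^ 2 = (m : ℂ)) (hlam0 : lam ≠ 0) (h1l : 1 - lam ≠ 0) (h1l' : 1 + lam ≠ 0) :
    Module.End.eigenspace (complexBetti.map φ.hom.hom.hom 1).hom μ ≤
      (Module.End.eigenspace (complexBetti.map (etaTwo A φ m).hom.hom.hom 1).hom (μ * (1 + lam))).map
        (complexBetti.map (biproduct.ι (fun _ : Fin 2 => A) 0).hom.hom.hom 1).hom := by
  intro y hy
  rw [eigenspace_etaTwo_eq_map hφ hd hμ hlam hlam0 h1l h1l', ← Submodule.map_comp]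
  refine ⟨y, hy, ?_⟩
  rw [LinearMap.comp_apply, LinearMap.add_apply, LinearMap.smul_apply, map_add, map_smul]
  change complexBetti.map (biproduct.ι (fun _ : Fin 2 => A) 0).hom.hom.hom 1
        (complexBetti.map (biproduct.π (fun _ : Fin 2 => A) 0).hom.hom.hom 1 y) +
      lam • complexBetti.map (biproduct.ι (fun _ : Fin 2 => A) 0).hom.hom.hom 1
        (complexBetti.map (biproduct.π (fun _ : Fin 2 => A) 1).hom.hom.hom 1 y) = y
  rw [map_ι_map_π_self, map_ι_map_π_ne _ (by decide), smul_zero, add_zero]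

/-- `φ^*` is diagonalisable on `H¹(A(ℂ); ℂ)` when `φ ≫ φ = -d`, `d ≥ 1` (`H¹ = V₊ ⊕ V₋`). -/
theorem iSup_eigenspace_eq_top_of_comp_self (hd : 0 < d) (hφ : φ ≫ φ = -(d • 𝟙 A)) :
    ⨆ μ : ℂ, Module.End.eigenspace (complexBetti.map φ.hom.hom.hom 1).hom μ = ⊤ := by
  refine eq_top_iff.2 ?_
  rw [← eigenspace_sup_eigenspace_neg_eq_top hd hφ]
  exact sup_le (le_iSup (fun μ : ℂ => Module.End.eigenspace (complexBetti.map φ.hom.hom.hom 1).hom μ) _)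
    (le_iSup (fun μ : ℂ => Module.End.eigenspace (complexBetti.map φ.hom.hom.hom 1).hom μ) _)

/-! ## §3 `H^r`: the eigenclass space `⋀ʳ V_μ(A)` is `ι₀^*` of `⋀ʳ V_{μ(1+λ)}(⨁_{Fin 2} A)` -/

/-- **`⋀ʳ V_μ(A) ⊆ ι₀^*(⋀ʳ V_{μ(1+λ)}(B))`** on the carriers `H^r(-(ℂ); ℂ)` (`H^r = ⋀ʳ H¹` for abelian varieties). -/
theorem pullbackEigenclasses_le_map_ι_twelvefold (hd : 0 < d) (hφ : φ ≫ φ = -(d • 𝟙 A)) {μ lam : ℂ}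
    (hμ : μ ^ 2 = -(d : ℂ)) (hlam : lam ^ 2 = (m : ℂ)) (hlam0 : lam ≠ 0) (h1l : 1 - lam ≠ 0) (h1l' : 1 + lam ≠ 0)
    (r : ℕ) :
    pullbackEigenclasses A φ r (fun x y => ((x : ℂ) + (y : ℂ) * μ) ^ r) ≤
      (pullbackEigenclasses (twelvefold A) (etaTwo A φ m) r (fun x y => ((x : ℂ) + (y : ℂ) * (μ * (1 + lam))) ^ r)).map
        (complexBetti.map (biproduct.ι (fun _ : Fin 2 => A) 0).hom.hom.hom r).hom := by
  haveI : FiniteDimensional ℂ (complexBetti A.X 1) := finite_complexBetti_abelianVariety A 1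
  have hdC : (d : ℂ) ≠ 0 := Nat.cast_ne_zero.2 hd.ne'
  rw [pullbackEigenclasses_eq_map_wedgeToCup, pullbackEigenclasses_eq_map_wedgeToCup,
    ← range_map_eigenspace_eq_pencilEigenspace ℂ _ _ (iSup_eigenspace_eq_top_of_comp_self hd hφ) r μ]
  calc _ ≤ ((LinearMap.range (exteriorPower.map r
            (Module.End.eigenspace (complexBetti.map (etaTwo A φ m).hom.hom.hom 1).hom (μ * (1 + lam))).subtype)).map
          (exteriorPower.map r (complexBetti.map (biproduct.ι (fun _ : Fin 2 => A) 0).hom.hom.hom 1).hom)).map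
          (wedgeToCup ℂ (ComplexPoints A.X) r) :=
        Submodule.map_mono (range_exteriorPower_map_subtype_le_map _ _ _
          (eigenspace_le_map_ι_eigenspace_etaTwo hφ hdC hμ hlam hlam0 h1l h1l') r)
    _ = ((LinearMap.range (exteriorPower.map r
            (Module.End.eigenspace (complexBetti.map (etaTwo A φ m).hom.hom.hom 1).hom (μ * (1 + lam))).subtype)).map
          (wedgeToCup ℂ (ComplexPoints (twelvefold A).X) r)).map
          (complexBetti.map (biproduct.ι (fun _ : Fin 2 => A) 0).hom.hom.hom r).hom := by
        rw [← Submodule.map_comp, ← Submodule.map_comp]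
        congr 1
        refine LinearMap.ext fun w => ?_
        rw [LinearMap.comp_apply, LinearMap.comp_apply]
        exact (Literature.AlgebraicGeometry.Motives.complexBetti_map_wedgeToCup
          (biproduct.ι (fun _ : Fin 2 => A) 0).hom.hom.hom r w).symm
    _ ≤ _ := Submodule.map_mono (Submodule.map_mono
          (range_map_eigenspace_le_pencilEigenspace ℂ _ _ r (μ * (1 + lam))))

/-! ## §4 `W_K(A) ⊗ ℂ ⊆ ι₀^*(W_L(⨁_{Fin 2} A) ⊗ ℂ)` -/

/-- **The `K`-Weil plane of `A` lies in `ι₀^*` of the `L`-Weil space of `(⨁_{Fin 2} A, η)`** (both lines `⋀^{2n} V_{±i√d}`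
come from `⋀^{2n} V_{±i√d(1+√m)}`, and `± i√d(1 + √m)` are roots of `R_(d,m)(T²)`). -/
theorem weilClassesOf_le_map_ι_weilClassesField_twelvefold (hd : 0 < d) (hm : ¬ IsSquare m)
    (hφ : φ ≫ φ = -(d • 𝟙 A)) (n : ℕ) :
    weilClassesOf A φ n d ≤
      (weilClassesField (twelvefold A) (etaTwo A φ m) ((bqPoly d m).comp (X ^ 2)) (2 * n)).map
        (complexBetti.map (biproduct.ι (fun _ : Fin 2 => A) 0).hom.hom.hom (2 * n)).hom := by
  have hlam' : ((Real.sqrt m : ℝ) : ℂ) = (Real.sqrt m : ℂ) ∨ ((Real.sqrt m : ℝ) : ℂ) = -(Real.sqrt m : ℂ) :=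
    Or.inl rfl
  have hlam : ((Real.sqrt m : ℝ) : ℂ) ^ 2 = (m : ℂ) := sq_eq_of_sqrt_sign hlam'
  obtain ⟨h1l', h1l⟩ := one_add_ne_zero_of_sqrt_sign hm hlam'
  have hlam0 : ((Real.sqrt m : ℝ) : ℂ) ≠ 0 := by
    intro h
    apply ne_zero_of_not_isSquare hm
    rw [h, zero_pow two_ne_zero] at hlam
    exact_mod_cast hlam.symm
  refine sup_le ?_ ?_
  · have hμ' : Complex.I * (Real.sqrt d : ℂ) = Complex.I * (Real.sqrt d : ℂ) ∨
        Complex.I * (Real.sqrt d : ℂ) = -(Complex.I * (Real.sqrt d : ℂ)) := Or.inl rfl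
    have e : (fun x y : ℕ => ((x : ℂ) + (y : ℂ) * Complex.I * (Real.sqrt d : ℂ)) ^ (2 * n)) =
        fun x y : ℕ => ((x : ℂ) + (y : ℂ) * (Complex.I * (Real.sqrt d : ℂ))) ^ (2 * n) := by
      funext x y; rw [mul_assoc]
    rw [weilClassesPlus, e]
    refine (pullbackEigenclasses_le_map_ι_twelvefold hd hφ (sq_eq_neg_of_root_sign hμ') hlam hlam0 h1l h1l'
      (2 * n)).trans (Submodule.map_mono ?_)
    exact pullbackEigenclasses_le_weilClassesField (bq_comp_eval₂_eq_zero_of_root d m hμ' hlam')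
  · have hμ' : -(Complex.I * (Real.sqrt d : ℂ)) = Complex.I * (Real.sqrt d : ℂ) ∨
        -(Complex.I * (Real.sqrt d : ℂ)) = -(Complex.I * (Real.sqrt d : ℂ)) := Or.inr rfl
    have e : (fun x y : ℕ => ((x : ℂ) - (y : ℂ) * Complex.I * (Real.sqrt d : ℂ)) ^ (2 * n)) =
        fun x y : ℕ => ((x : ℂ) + (y : ℂ) * (-(Complex.I * (Real.sqrt d : ℂ)))) ^ (2 * n) := by
      funext x y; rw [mul_neg, ← sub_eq_add_neg, mul_assoc]
    rw [weilClassesMinus, e]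
    refine (pullbackEigenclasses_le_map_ι_twelvefold hd hφ (sq_eq_neg_of_root_sign hμ') hlam hlam0 h1l h1l'
      (2 * n)).trans (Submodule.map_mono ?_)
    exact pullbackEigenclasses_le_weilClassesField (bq_comp_eval₂_eq_zero_of_root d m hμ' hlam')

/-! ## §5 Transport `⨁_{Fin 2} A → A ⊞ A` -/

/-- `inl ≫ (A ⊞ A ≅ ⨁_{Fin 2} A) = ι₀`. -/
theorem biprod_inl_comp_biprodIsoTwelvefold_hom (A : AbelianVariety ℂ) :
    (biprod.inl : A ⟶ A ⊞ A) ≫ (biprodIsoTwelvefold A).hom = biproduct.ι (fun _ : Fin 2 => A) 0 := by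
  refine twelvefold_hom_ext A ?_ ?_
  · rw [Category.assoc, biprodIsoTwelvefold_hom_π_zero, biprod.inl_fst, biproduct.ι_π_self]
  · rw [Category.assoc, biprodIsoTwelvefold_hom_π_one, biprod.inl_snd, biproduct.ι_π_ne _ (by decide)]

/-- **`W_K(A) ⊗ ℂ ⊆ inl^*(W_L(A ⊞ A, η_(d,m)) ⊗ ℂ)`** for the route's `η_(d,m) = (φ ⊞ φ) ≫ (𝟙 + ψ_m)` on `A ⊞ A`. -/
theorem weilClassesOf_le_map_inl_weilClassesField (hd : 0 < d) (hm : ¬ IsSquare m) (hφ : φ ≫ φ = -(d • 𝟙 A))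
    (n : ℕ) :
    weilClassesOf A φ n d ≤
      (weilClassesField (A ⊞ A) (etaBiprod A φ m) ((bqPoly d m).comp (X ^ 2)) (2 * n)).map
        (complexBetti.map (biprod.inl : A ⟶ A ⊞ A).hom.hom.hom (2 * n)).hom := by
  refine (weilClassesOf_le_map_ι_weilClassesField_twelvefold hd hm hφ n).trans ?_
  have hf : (biprodIsoTwelvefold A).hom ≫ etaTwo A φ m = etaBiprod A φ m ≫ (biprodIsoTwelvefold A).hom :=
    (etaBiprod_comp_biprodIsoTwelvefold_hom A φ m).symm
  have h1 := weilClassesField_map_le_of_comm hf ((bqPoly d m).comp (X ^ 2)) (2 * n)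
  have hcomp : (complexBetti.map (biproduct.ι (fun _ : Fin 2 => A) 0).hom.hom.hom (2 * n)).hom =
      (complexBetti.map (biprod.inl : A ⟶ A ⊞ A).hom.hom.hom (2 * n)).hom ∘ₗ
        (complexBetti.map (biprodIsoTwelvefold A).hom.hom.hom.hom (2 * n)).hom := by
    refine LinearMap.ext fun c => ?_
    rw [← biprod_inl_comp_biprodIsoTwelvefold_hom]
    exact (abelianVarietyHom_map_map_apply (biprod.inl : A ⟶ A ⊞ A) (biprodIsoTwelvefold A).hom c).symm
  rw [hcomp, Submodule.map_comp]
  exact Submodule.map_mono h1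

/-! ## §6 X3 -/

/-- **X3 `BiquadraticWeilDescent` (stmt-HodgeConjecture-22134), proved.** See the module docstring.
HC is NOT proved by this theorem. -/
theorem biquadraticWeilDescent_proof :
    Summit.HodgeConjecture.HodgeConjecture.Theses.BiquadraticSecantLift.BiquadraticWeilDescent := by
  intro d m hd _hm hsq A φ _hA hφ hW halg c _hcQ _hc33 hcW
  -- §1: all of `W_L ⊗ ℂ` is algebraic on `A ⊞ A`
  have hWalg : weilClassesField (A ⊞ A) (etaBiprod A φ m) ((bqPoly d m).comp (X ^ 2)) (2 * 3) ≤
      algebraicClasses (A ⊞ A).X 3 :=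
    hW.weilClassesField_le_algebraicClasses_of_forall_isRationalClass fun c' hc' hQ' =>
      halg c' hc' hQ' (hW.isOfHodgeType_of_mem_weilClassesField' hc')
  -- §2–§5: `c = inl^* c'` with `c' ∈ W_L ⊗ ℂ`
  obtain ⟨c', hc', rfl⟩ := weilClassesOf_le_map_inl_weilClassesField hd hsq hφ 3 hcW
  -- §6: pull-back preserves algebraic classes
  exact map_mem_algebraicClasses_of_abelianVariety
    (Literature.AlgebraicGeometry.Motives.AbelianVariety.isSmoothProjective_holds (A := A)) (A ⊞ A)
    (biprod.inl : A ⟶ A ⊞ A).hom.hom.hom (hWalg hc')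

end Summit.HodgeConjecture.HodgeConjecture.BiquadraticSecantLift
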